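import Mathlib.Analysis.Convex.Combination
import Mathlib.Combinatorics.SimpleGraph.Hamiltonian
import Mathlib.Data.Matrix.Mul
import Mathlib.Analysis.SpecialFunctions.Pow.Real
import Mathlib.Analysis.SpecialFunctions.Pow.Asymptotics
import Mathlib.Order.Filter.AtTopBot.Basic
import HarnessLib

/-!
# Barrier catalogue `PneNP`: no polynomial-size LP for the traveling salesman polytope
(Yannakakis 1991; Fiorini–Massar–Pokutta–Tiwary–de Wolf 2015; Rothvoß 2017)

D-0021 barrier entry for the summit `PneNP`, on its NEGATIVE side (attempts to prove `P = NP`,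
staffed as the "¬X" items of the routes): "In 1986–1987 there were attempts [Swart] to prove
`P = NP` by giving a polynomial-size LP that would solve the traveling salesman problem ...
Yannakakis proved that every symmetric LP for the TSP has exponential size ... We solve this
question by proving a super-polynomial lower bound on the number of inequalities in every LP for
the TSP. ... Therefore, it is impossible to prove `P = NP` by means of a polynomial-size LP that
expresses any of these problems" (FMPTW, §1).

**The printed results.**

* S. Fiorini, S. Massar, S. Pokutta, H. R. Tiwary, R. de Wolf, *Exponential lower bounds for
  polytopes in combinatorial optimization*, J. ACM 62 (2015) = STOC 2012 = arXiv:1111.0837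
  (held, `lit read arxiv:1111.0837`, 19 PDF pages): §1 (PDF p. 3): an **extended formulation**
  (EF) of a polytope `P ⊆ ℝ^d` is a linear system `E x + F y = g, y ≥ 0` in variables
  `(x, y) ∈ ℝ^{d+r}` "such that `x ∈ P` if and only if there exists `y` such that [it] holds. The
  size of an EF is defined as its number of inequalities in the system" (slack form w.l.o.g.); an
  LP "solves" a problem when it is "an LP over this set of [natural] variables plus extra
  variables" (§1.1); "the TSP polytope `TSP(n)` is the convex hull of all points
  `x ∈ {0,1}^{(n choose 2)}` that correspond to a Hamiltonian cycle in the complete `n`-vertex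
  graph `K_n`" (§1.1; §3.4, PDF p. 10: `TSP(n) := conv{χ^F ∈ ℝ^{E_n} | F ⊆ E_n is a tour of
  K_n}`); the **extension complexity** `xc(P)` is "the minimum size (i.e., number of
  inequalities) of an EF of `P`" (§3, PDF p. 8). **Thm. 12** (PDF p. 11): "The extension
  complexity of the TSP polytope `TSP(n)` is `2^{Ω(n^{1/2})}`." Route of proof: Thm. 3
  (Yannakakis' factorization theorem: `xc(P)` = nonnegative rank of the slack matrix), Thm. 4
  (rectangle covering lower bound), Thm. 1 (de Wolf: the unique-disjointness support matrix needs
  `2^{Ω(n)}` rectangles), Thm. 7 (`xc(CUT(n+1)) = xc(COR(n)) ≥ 2^{Ω(n)}`), Lemma 9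
  (monotonicity: extensions and faces), Lemma 11 (`COR(n)` is a projection of a face of
  `TSP(O(n²))`, via the 3SAT→HAMPATH gadgets), Thm. 10 (stable set polytopes `2^{Ω(√n)}`).
* T. Rothvoß, *The matching polytope has exponential extension complexity*, J. ACM 64 (2017) =
  STOC 2014 = arXiv:1311.2369 (held): abstract (PDF p. 2): "the extension complexity of the
  perfect matching polytope in a complete `n`-node graph is `2^{Ω(n)}`. By a known reduction this
  also improves the lower bound on the extension complexity for the TSP polytope from `2^{Ω(√n)}`
  to `2^{Ω(n)}`"; §1 (PDF p. 3): Yannakakis' symmetric lower bound "allowed to reject a sequence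
  of flawed `P = NP` proofs, which claimed to have (complicated) polynomial size LPs for TSP";
  Kaibel–Pashkovich–Theis: symmetry is a genuine restriction.

**What this file adds.** The technique class as explicit definitions over Mathlib: extended
formulations in slack form over a finite coordinate type (`ExtendedFormulation`, its feasible
projection `ExtendedFormulation.projSet`, `HasEFOfSize P r`), tours of `K_n` as edge sets of
Hamiltonian cycles of `⊤ : SimpleGraph (Fin n)` (`IsTourEdgeSet`, Mathlib's
`SimpleGraph.Walk.IsHamiltonianCycle`), characteristic vectors and `tspPolytope n` (Mathlib's
`convexHull`); the barrier fact `TSPExtensionComplexity` = FMPTW Thm. 12 in junk-free form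
("every EF of `TSP(n)` has size `≥ 2^{c√n}`", eventually in `n`), the stronger Rothvoß bound as
a second named fact (`Rothvoss2017_tsp`), and the PROVED readings: no polynomial size bound
(`TSPExtensionComplexity.not_poly`) and the `¬∃`-form of "a polynomial-size LP that expresses the
TSP" (`TSPExtensionComplexity.no_polysize_ef`).

## Sources

* [FioriniEtAl2015] arXiv:1111.0837: abstract (PDF p. 2), §1–1.1 (PDF
  pp. 3–5), §2 Thm. 1 (PDF p. 7), §3 Thms. 3, 4, 7 (PDF pp. 8–9), Lemma 9, Thm. 10, §3.4
  Lemma 11, Thm. 12 (PDF pp. 10–11) — held.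
* [Rothvoss2017] arXiv:1311.2369: abstract (PDF p. 2), §1 (PDF p. 3) — held.
* M. Yannakakis, *Expressing combinatorial optimization problems by linear programs*, JCSS 43
  (1991) — through both of the above (text not consulted).
-/

noncomputable section

namespace Literature.Barriers.PneNP

open Filter Matrix

/-! ### Extended formulations (slack form) and extension complexity -/

/-- An **extended formulation in slack form** with `r` inequalities for a set of points of
`ℝ^ι` (`ι` the natural coordinates): `k` equations `E x + F y = g` in the natural variables
`x ∈ ℝ^ι` and `r` extra variables `y ≥ 0` ("we restrict ourselves to linear systems in slack
form, that is, containing only equalities and nonnegativity inequalities ... without loss of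
generality"; "The size of an EF is defined as its number of inequalities in the system", here
`r`). [cite: FioriniEtAl2015, §1 (PDF p. 3, eq. (1))] -/
structure ExtendedFormulation (ι : Type) [Fintype ι] (r : ℕ) where
  /-- number of equality constraints -/
  k : ℕ
  /-- coefficients of the natural variables -/
  E : Matrix (Fin k) ι ℝ
  /-- coefficients of the extra (slack) variables -/
  F : Matrix (Fin k) (Fin r) ℝ
  /-- right-hand side -/
  g : Fin k → ℝ

variable {ι : Type} [Fintype ι] {r : ℕ}

/-- The projection to the natural variables of the feasible region:
`{x | ∃ y ≥ 0, E x + F y = g}`. [cite: FioriniEtAl2015, §1 (PDF p. 3: "x ∈ P if and only if there exists y such that (1) holds")] -/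
def ExtendedFormulation.projSet (Q : ExtendedFormulation ι r) : Set (ι → ℝ) :=
  {x | ∃ y : Fin r → ℝ, (∀ j, 0 ≤ y j) ∧ Q.E *ᵥ x + Q.F *ᵥ y = Q.g}

/-- **`P` has an extended formulation of size `r`**: some slack-form system with `r`
inequalities projects exactly onto `P`. The EXTENSION COMPLEXITY `xc(P)` is the least such `r`
("the minimum size (i.e., number of inequalities) of an EF of `P`"); the facts below bound every
such `r` from below, avoiding a junk-valued infimum. [cite: FioriniEtAl2015, §1 (PDF p. 3) and §3 (PDF p. 8)] -/
def HasEFOfSize (P : Set (ι → ℝ)) (r : ℕ) : Prop :=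
  ∃ Q : ExtendedFormulation ι r, Q.projSet = P

/-- Adding an unused slack variable: an EF of size `r` gives one of size `r + 1` (so
"`xc(P) ≤ r`" is upward closed, as a minimum should be). [folklore] -/
theorem HasEFOfSize.succ {P : Set (ι → ℝ)} (h : HasEFOfSize P r) : HasEFOfSize P (r + 1) := by
  obtain ⟨Q, hQ⟩ := h
  refine ⟨⟨Q.k, Q.E, Matrix.of fun i j => Fin.lastCases 0 (fun j' => Q.F i j') j, Q.g⟩, ?_⟩
  rw [← hQ]
  ext x
  simp only [ExtendedFormulation.projSet, Set.mem_setOf_eq]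
  constructor
  · rintro ⟨y, hy, hE⟩
    refine ⟨Fin.init y, fun j => hy _, ?_⟩
    rw [← hE]
    congr 1
    funext i
    simp only [mulVec, dotProduct, Matrix.of_apply]
    rw [Fin.sum_univ_castSucc]
    simp [Fin.init]
  · rintro ⟨y, hy, hE⟩
    refine ⟨Fin.snoc y 0, fun j => ?_, ?_⟩
    · refine Fin.lastCases ?_ (fun j' => ?_) j <;> simp [hy]
    · rw [← hE]
      congr 1
      funext i
      simp only [mulVec, dotProduct, Matrix.of_apply]
      rw [Fin.sum_univ_castSucc]
      simp

/-- Monotonicity of `HasEFOfSize` in the size. [folklore] -/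
theorem HasEFOfSize.of_le {P : Set (ι → ℝ)} {r r' : ℕ} (h : HasEFOfSize P r) (hle : r ≤ r') :
    HasEFOfSize P r' := by
  induction hle with
  | refl => exact h
  | step _ ih => exact ih.succ

/-! ### Every finite convex hull has an extended formulation (non-vacuity) -/

/-- The V-representation EF of the convex hull of `N` listed points `p_j`: extra variables
`λ ∈ ℝ^N`, `λ ≥ 0`, equations `Σ_j λ_j = 1` and `x_i - Σ_j λ_j p_j(i) = 0` (rows indexed by
`Option ι` through `Fintype.equivFin`) — size `N`. [folklore] -/
def vRepEF [DecidableEq ι] {N : ℕ} (pt : Fin N → ι → ℝ) : ExtendedFormulation ι N where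
  k := Fintype.card (Option ι)
  E := Matrix.of fun a i => match (Fintype.equivFin (Option ι)).symm a with
    | none => 0
    | some i' => if i = i' then 1 else 0
  F := Matrix.of fun a j => match (Fintype.equivFin (Option ι)).symm a with
    | none => 1
    | some i' => -(pt j i')
  g := fun a => match (Fintype.equivFin (Option ι)).symm a with
    | none => 1
    | some _ => 0

/-- Rows of the V-representation system, unfolded. [folklore] -/
theorem vRepEF_row [DecidableEq ι] {N : ℕ} (pt : Fin N → ι → ℝ) (x : ι → ℝ) (y : Fin N → ℝ)
    (a : Fin (Fintype.card (Option ι))) :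
    ((vRepEF pt).E *ᵥ x + (vRepEF pt).F *ᵥ y) a =
      (∑ i, (vRepEF pt).E a i * x i) + ∑ j, (vRepEF pt).F a j * y j := rfl

/-- The normalisation row `Σ λ_j = 1`. [folklore] -/
theorem vRepEF_none [DecidableEq ι] {N : ℕ} (pt : Fin N → ι → ℝ) (x : ι → ℝ) (y : Fin N → ℝ)
    {a : Fin (Fintype.card (Option ι))} (ha : (Fintype.equivFin (Option ι)).symm a = none) :
    ((vRepEF pt).E *ᵥ x + (vRepEF pt).F *ᵥ y) a = ∑ j, y j ∧ (vRepEF pt).g a = 1 := by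
  rw [vRepEF_row]
  have hE : ∀ i, (vRepEF pt).E a i = 0 := fun i => by
    simp only [vRepEF, Matrix.of_apply, ha]
  have hF : ∀ j, (vRepEF pt).F a j = 1 := fun j => by
    simp only [vRepEF, Matrix.of_apply, ha]
  have hg : (vRepEF pt).g a = 1 := by simp only [vRepEF, ha]
  simp [hE, hF, hg]

/-- The coordinate rows `x_i - Σ_j λ_j p_j(i) = 0`. [folklore] -/
theorem vRepEF_some [DecidableEq ι] {N : ℕ} (pt : Fin N → ι → ℝ) (x : ι → ℝ) (y : Fin N → ℝ)
    {a : Fin (Fintype.card (Option ι))} {i : ι} (ha : (Fintype.equivFin (Option ι)).symm a = some i) :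
    ((vRepEF pt).E *ᵥ x + (vRepEF pt).F *ᵥ y) a = x i - ∑ j, y j * pt j i ∧ (vRepEF pt).g a = 0 := by
  rw [vRepEF_row]
  have hE : ∀ i', (vRepEF pt).E a i' = if i' = i then 1 else 0 := fun i' => by
    simp only [vRepEF, Matrix.of_apply, ha]
  have hF : ∀ j, (vRepEF pt).F a j = -(pt j i) := fun j => by
    simp only [vRepEF, Matrix.of_apply, ha]
  have hg : (vRepEF pt).g a = 0 := by simp only [vRepEF, ha]
  refine ⟨?_, hg⟩
  simp only [hE, hF, ite_mul, one_mul, zero_mul, Finset.sum_ite_eq', Finset.mem_univ, if_true]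
  rw [sub_eq_add_neg, ← Finset.sum_neg_distrib]
  congr 1
  exact Finset.sum_congr rfl fun j _ => by ring

/-- The V-representation system says exactly: `λ` sums to `1` and `x = Σ λ_j p_j`. [folklore] -/
theorem vRepEF_system [DecidableEq ι] {N : ℕ} (pt : Fin N → ι → ℝ) (x : ι → ℝ) (y : Fin N → ℝ) :
    (vRepEF pt).E *ᵥ x + (vRepEF pt).F *ᵥ y = (vRepEF pt).g ↔
      (∑ j, y j = 1 ∧ ∀ i, x i = ∑ j, y j * pt j i) := by
  set e := (Fintype.equivFin (Option ι)).symm with he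
  constructor
  · intro h
    have hrow : ∀ a, ((vRepEF pt).E *ᵥ x + (vRepEF pt).F *ᵥ y) a = (vRepEF pt).g a :=
      fun a => congrFun h a
    constructor
    · obtain ⟨h1, h2⟩ := vRepEF_none pt x y (a := e.symm none) (by simp [he])
      have := hrow (e.symm none)
      rwa [h1, h2] at this
    · intro i
      obtain ⟨h1, h2⟩ := vRepEF_some pt x y (a := e.symm (some i)) (i := i) (by simp [he])
      have := hrow (e.symm (some i))
      rw [h1, h2] at this
      linarith
  · rintro ⟨hsum, hx⟩
    funext a
    rcases ha : e a with _ | i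
    · obtain ⟨h1, h2⟩ := vRepEF_none pt x y (a := a) (by simpa [he] using ha)
      rw [h1, h2, hsum]
    · obtain ⟨h1, h2⟩ := vRepEF_some pt x y (a := a) (i := i) (by simpa [he] using ha)
      rw [h1, h2, hx i, sub_self]

/-- **The convex hull of `N` points has an extended formulation of size `N`** (its
V-representation: `x = Σ λ_j p_j`, `Σ λ_j = 1`, `λ ≥ 0`; Mathlib's `Finset.convexHull_eq`). In
particular polytopes given as convex hulls of finitely many points — such as `TSP(n)` — do have
EFs, so lower bounds on `HasEFOfSize` are not vacuous. [cite: FioriniEtAl2015, §1 (PDF p. 3: "the feasible solutions ... yield a polytope that is the convex hull of the resulting points")] -/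
theorem hasEFOfSize_convexHull_finset [DecidableEq ι] (S : Finset (ι → ℝ)) :
    HasEFOfSize (convexHull ℝ (S : Set (ι → ℝ))) S.card := by
  classical
  let pt : Fin S.card → ι → ℝ := fun j => (S.equivFin.symm j : ι → ℝ)
  refine ⟨vRepEF pt, ?_⟩
  ext x
  simp only [ExtendedFormulation.projSet, Set.mem_setOf_eq, vRepEF_system]
  rw [Finset.convexHull_eq, Set.mem_setOf_eq]
  constructor
  · rintro ⟨y, hy, hsum, hx⟩
    refine ⟨fun s => if hs : s ∈ S then y (S.equivFin ⟨s, hs⟩) else 0, fun s hs => by simp [hs, hy],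
      ?_, ?_⟩
    · rw [← hsum, ← Finset.sum_coe_sort S]
      rw [← Equiv.sum_comp S.equivFin.symm]
      refine Finset.sum_congr rfl fun j _ => ?_
      simp
    · have hsum' : ∑ s ∈ S, (fun s => if hs : s ∈ S then y (S.equivFin ⟨s, hs⟩) else 0) s = 1 := by
        rw [← hsum, ← Finset.sum_coe_sort S, ← Equiv.sum_comp S.equivFin.symm]
        refine Finset.sum_congr rfl fun j _ => ?_
        simp
      rw [Finset.centerMass_eq_of_sum_1 _ _ hsum']
      funext i
      rw [hx i, Finset.sum_apply, ← Finset.sum_coe_sort S, ← Equiv.sum_comp S.equivFin.symm]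
      refine Finset.sum_congr rfl fun j _ => ?_
      simp [pt]
  · rintro ⟨w, hw0, hw1, hcm⟩
    refine ⟨fun j => w (S.equivFin.symm j), fun j => hw0 _ (S.equivFin.symm j).2, ?_, ?_⟩
    · rw [← hw1, ← Finset.sum_coe_sort S, ← Equiv.sum_comp S.equivFin.symm]
    · intro i
      rw [← hcm, Finset.centerMass_eq_of_sum_1 _ _ hw1, Finset.sum_apply,
        ← Finset.sum_coe_sort S, ← Equiv.sum_comp S.equivFin.symm]
      refine Finset.sum_congr rfl fun j _ => ?_
      simp [pt, mul_comm]

/-! ### Tours of `K_n` and the TSP polytope -/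

/-- The edge set `F ⊆ E_n` of a **tour** (Hamiltonian cycle) of the complete graph `K_n` on
`Fin n`: the edges of some Hamiltonian cycle of `⊤ : SimpleGraph (Fin n)` (Mathlib's
`SimpleGraph.Walk.IsHamiltonianCycle`). [cite: FioriniEtAl2015, §3.4 (PDF p. 10: "F ⊆ E_n that define a tour of K_n")] -/
def IsTourEdgeSet {n : ℕ} (F : Finset (Sym2 (Fin n))) : Prop :=
  ∃ (u : Fin n) (p : (⊤ : SimpleGraph (Fin n)).Walk u u), p.IsHamiltonianCycle ∧ F = p.edges.toFinset

/-- The characteristic vector `χ^F ∈ ℝ^{E_n}` of an edge set, indexed by the edges of `K_n`.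
[cite: FioriniEtAl2015, §3.4 (PDF p. 10)] -/
def charVec {n : ℕ} (F : Finset (Sym2 (Fin n))) : (⊤ : SimpleGraph (Fin n)).edgeSet → ℝ :=
  fun e => if (e : Sym2 (Fin n)) ∈ F then 1 else 0

/-- **The TSP polytope** `TSP(n) := conv{χ^F ∈ ℝ^{E_n} | F ⊆ E_n is a tour of K_n}` (Mathlib's
`convexHull ℝ`). [cite: FioriniEtAl2015, §1.1 (PDF p. 3) and §3.4 (PDF p. 10)] -/
def tspPolytope (n : ℕ) : Set ((⊤ : SimpleGraph (Fin n)).edgeSet → ℝ) :=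
  convexHull ℝ {x | ∃ F : Finset (Sym2 (Fin n)), IsTourEdgeSet F ∧ x = charVec F}

/-- Every tour's characteristic vector lies in the TSP polytope. [folklore] -/
theorem charVec_mem_tspPolytope {n : ℕ} {F : Finset (Sym2 (Fin n))} (hF : IsTourEdgeSet F) :
    charVec F ∈ tspPolytope n :=
  subset_convexHull ℝ _ ⟨F, hF, rfl⟩

/-- The finitely many tour vectors of `K_n`, as a `Finset`. [folklore] -/
def tourVectors (n : ℕ) : Finset ((⊤ : SimpleGraph (Fin n)).edgeSet → ℝ) := by
  classical
  exact (Finset.univ.filter fun F : Finset (Sym2 (Fin n)) => IsTourEdgeSet F).image charVec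

/-- `TSP(n)` is the convex hull of the finite set of tour vectors. [cite: FioriniEtAl2015, §3.4 (PDF p. 10)] -/
theorem tspPolytope_eq_convexHull_tourVectors (n : ℕ) :
    tspPolytope n = convexHull ℝ (tourVectors n : Set ((⊤ : SimpleGraph (Fin n)).edgeSet → ℝ)) := by
  classical
  unfold tspPolytope tourVectors
  congr 1
  ext x
  simp only [Set.mem_setOf_eq, Finset.coe_image, Finset.coe_filter, Finset.mem_univ, true_and,
    Set.mem_image]
  constructor
  · rintro ⟨F, hF, rfl⟩; exact ⟨F, hF, rfl⟩
  · rintro ⟨F, hF, rfl⟩; exact ⟨F, hF, rfl⟩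

/-- **`TSP(n)` has an extended formulation** (of size the number of tour vectors), so the lower
bound `TSPExtensionComplexity` quantifies over a nonempty family. [folklore] -/
theorem hasEFOfSize_tspPolytope (n : ℕ) : HasEFOfSize (tspPolytope n) (tourVectors n).card := by
  classical
  rw [tspPolytope_eq_convexHull_tourVectors]
  exact hasEFOfSize_convexHull_finset _

/-! ### The barrier fact: FMPTW Theorem 12 -/

/-- **Fiorini–Massar–Pokutta–Tiwary–de Wolf 2015, Thm. 12: "The extension complexity of the TSP
polytope `TSP(n)` is `2^{Ω(n^{1/2})}`."** Junk-free form: there is `c > 0` such that for all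
large `n`, EVERY extended formulation of `TSP(n)` (slack form over the natural edge variables of
`K_n` plus extra variables) has at least `2^{c√n}` inequalities. Hence "it is impossible to prove
`P = NP` by means of a polynomial-size LP that expresses" the TSP (§1).

BARRIER
technique_class: polynomial-size-lp, extended-formulations, compact-lp-formulations, lp-for-tsp, symmetric-lp, extension-complexity
blocks: proofs of `P = NP` — the NEGATION of `PneNP` (the routes' staffed `¬X` items, e.g. PneNP/Circuit #6 `NP ⊆ P/poly` via an algorithm) — "by means of a polynomial-size LP that expresses" the traveling salesman problem, i.e. a linear program over the natural edge variables of `K_n` plus polynomially many extra variables and constraints whose feasible region projects exactly onto `TSP(n)` (`HasEFOfSize (tspPolytope n) (poly n)`; refuted eventually in `n`: `TSPExtensionComplexity.not_poly`, `.no_polysize_ef`), as in Swart's 1986–87 attempts; likewise for LPs expressing max-cut (`CUT(n)`, `2^{Ω(n)}`, Thm. 7) and maximum stable set (`STAB(G_n)`, `2^{Ω(√n)}`, Thm. 10) [cite: FioriniEtAl2015, §1 (PDF p. 3), Thm. 7 (PDF p. 9), Thm. 10 (PDF p. 10), Thm. 12 (PDF p. 11)]; the symmetric case is Yannakakis 1991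 (`2^{Ω(n)}` for symmetric EFs of `TSP(n)`), reported in [cite: FioriniEtAl2015, §1.1 (PDF p. 4)] [cite: Rothvoss2017, §1 (PDF p. 3)].
because: Yannakakis' factorization theorem — `xc(P)` equals the nonnegative rank of the slack matrix of `P` (Thm. 3) — and the rectangle-covering lower bound on nonnegative rank (Thm. 4); the `2ⁿ × 2ⁿ` matrix `M(a,b) = (1 - aᵀb)²` has a support matrix needing `2^{Ω(n)}` monochromatic 1-rectangles (de Wolf, via Razborov's disjointness lower bound; Thm. 1) and sits inside the slack matrix of the correlation/cut polytope, so `xc(COR(n)) = xc(CUT(n+1)) ≥ 2^{Ω(n)}` (Thm. 7); extension complexity is monotone under taking faces and extensions (Lemma 9), and `COR(n)` is a linear projection of a face of `TSP(q)`, `q = O(n²)`, by the standard 3SAT→HAMPATH gadget reduction applied to a formula whose satisfying assignments are the rank-one matrices `bbᵀ` (Lemma 11); hence `xc(TSP(n)) ≥ 2^{Ω(√n)}` [cite: FioriniEtAl2015, Thms. 1, 3, 4, 7 (PDF pp. 7–9), Lemma 9, Lemma 11, Thm. 12 (PDF pp. 10–11)].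
evasions_known: the bound was since raised to `2^{Ω(n)}` through the perfect matching polytope (`Rothvoss2017_tsp`) [cite: Rothvoss2017, abstract (PDF p. 2)]; NOT covered by the printed theorems: semidefinite extended formulations (the paper characterises SDP extension complexity by PSD rank and shows PSD rank can be exponentially SMALLER than nonnegative rank, Thm./§5; no SDP lower bound for TSP is printed here) [cite: FioriniEtAl2015, §1.2 (PDF p. 5: "exponential separation between nonnegative rank and PSD rank")]; LPs that do not express the polytope over its natural variables (different encodings, LPs correct only on some objective functions, approximate formulations) are outside the definition "an LP over this set of variables plus extra variables that returns the correct objective function value for all instances" [cite: FioriniEtAl2015, §1.1 (PDF p. 3)]; and small extension complexity is not necessary for polynomial-time solvability — the perfect matching polytope (optimisable in polynomial time, Edmonds) has `xc = 2^{Ω(n)}` [cite: Rothvoss2017, abstract (PDF p. 2)] — so the barrier constrains a proof FORMAT, not the truth of `P = NP`.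
scope_caveats: a barrier on the NEGATION of the summit (`P = NP` proofs), recorded because route kill criteria staff `¬X`; it excludes exactly: polynomially many inequalities in a slack-form linear system whose projection to the `(n choose 2)` edge coordinates IS `TSP(n)` — nothing about algorithms for TSP in general, about LPs in other variables, or about SDPs [cite: FioriniEtAl2015, §1.1 (PDF p. 3)]; the constant in `2^{Ω(√n)}` is existential and the bound is vendored eventually in `n`; `tspPolytope` uses Mathlib's `convexHull` and Hamiltonian cycles of `⊤ : SimpleGraph (Fin n)` (for `n ≤ 2` there are no tours and `TSP(n) = ∅`, harmless under "eventually"); size = number of nonnegativity constraints = number of extra variables in slack form, as in print.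
status: established [cite: FioriniEtAl2015, Thm. 12] [cite: Rothvoss2017, abstract] -/
def TSPExtensionComplexity : Prop :=
  ∃ c : ℝ, 0 < c ∧ ∀ᶠ n : ℕ in atTop, ∀ r : ℕ, HasEFOfSize (tspPolytope n) r →
    (2 : ℝ) ^ (c * Real.sqrt n) ≤ r

/-- **Rothvoß 2017 (via the perfect matching polytope): `xc(TSP(n)) = 2^{Ω(n)}`** — "By a known
reduction this also improves the lower bound on the extension complexity for the TSP polytope
from `2^{Ω(√n)}` to `2^{Ω(n)}`." Same junk-free form. [cite: Rothvoss2017, abstract (PDF p. 2)] -/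
def Rothvoss2017_tsp : Prop :=
  ∃ c : ℝ, 0 < c ∧ ∀ᶠ n : ℕ in atTop, ∀ r : ℕ, HasEFOfSize (tspPolytope n) r →
    (2 : ℝ) ^ (c * n) ≤ r

/-- Rothvoß's bound implies FMPTW's (`c n ≥ c √n` for `n ≥ 1`). [cite: Rothvoss2017, abstract (PDF p. 2)] -/
theorem Rothvoss2017_tsp.tspExtensionComplexity (h : Rothvoss2017_tsp) : TSPExtensionComplexity := by
  obtain ⟨c, hc, hev⟩ := h
  refine ⟨c, hc, ?_⟩
  filter_upwards [hev, eventually_ge_atTop 1] with n hn hn1 r hr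
  refine le_trans ?_ (hn r hr)
  apply Real.rpow_le_rpow_of_exponent_le one_le_two
  have hsq : Real.sqrt n ≤ n := by
    rw [Real.sqrt_le_left (by positivity)]
    have : (1 : ℝ) ≤ n := by exact_mod_cast hn1
    nlinarith
  exact mul_le_mul_of_nonneg_left hsq hc.le

/-! ### The no-go theorems (proved from the fact) -/

/-- For `c > 0`, `n^K + K < 2^{c√n}` for all large `n`. [folklore] -/
theorem eventually_pow_add_lt_two_rpow_sqrt (K : ℕ) {c : ℝ} (hc : 0 < c) :
    ∀ᶠ n : ℕ in atTop, ((n ^ K + K : ℕ) : ℝ) < (2 : ℝ) ^ (c * Real.sqrt n) := by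
  -- `(K+1) log n ≤ (c log 2 / 2) √n` eventually, from `log x = o(x^{1/2})`
  have hlog2 : 0 < Real.log 2 := Real.log_pos one_lt_two
  have hε : 0 < c * Real.log 2 / (2 * (K + 1)) := by positivity
  have ho := (isLittleO_log_rpow_atTop (show (0 : ℝ) < 1 / 2 by norm_num)).def hε
  have hreal : ∀ᶠ x : ℝ in atTop, x ^ K + K < (2 : ℝ) ^ (c * Real.sqrt x) := by
    filter_upwards [ho, eventually_ge_atTop (max (K : ℝ) 1 + 1)] with x hx hx1
    have hxK : (K : ℝ) ≤ x := by linarith [le_max_left (K : ℝ) 1]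
    have hx1' : 1 ≤ x := by linarith [le_max_right (K : ℝ) 1]
    have hx0 : 0 < x := by linarith
    rw [Real.norm_of_nonneg (Real.log_nonneg hx1'), Real.norm_of_nonneg (by positivity),
      ← Real.sqrt_eq_rpow] at hx
    have h1 : x ^ K + K ≤ x ^ (K + 1) := by
      have hxm1 : (K : ℝ) ≤ x - 1 := by linarith [le_max_left (K : ℝ) 1]
      have hxK1 : 1 ≤ x ^ K := one_le_pow₀ hx1'
      have hprod : (K : ℝ) ≤ x ^ K * (x - 1) :=
        calc (K : ℝ) = 1 * K := (one_mul _).symm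
          _ ≤ x ^ K * (x - 1) := mul_le_mul hxK1 hxm1 (Nat.cast_nonneg K) (by linarith)
      rw [pow_succ]
      nlinarith
    have h2 : x ^ (K + 1) = Real.exp ((K + 1) * Real.log x) := by
      rw [← Real.rpow_natCast, Real.rpow_def_of_pos hx0]; congr 1; push_cast; ring
    have h3 : (2 : ℝ) ^ (c * Real.sqrt x) = Real.exp (Real.log 2 * (c * Real.sqrt x)) := by
      rw [Real.rpow_def_of_pos two_pos]
    have hKpos : (0 : ℝ) < K + 1 := by positivity
    have h4 : (K + 1) * Real.log x < Real.log 2 * (c * Real.sqrt x) := by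
      have hs : 0 < Real.sqrt x := Real.sqrt_pos.2 hx0
      calc (K + 1) * Real.log x ≤ (K + 1) * (c * Real.log 2 / (2 * (K + 1)) * Real.sqrt x) :=
            mul_le_mul_of_nonneg_left hx hKpos.le
        _ = Real.log 2 * (c * Real.sqrt x) / 2 := by field_simp
        _ < Real.log 2 * (c * Real.sqrt x) := by
            have : 0 < Real.log 2 * (c * Real.sqrt x) := by positivity
            linarith
    calc x ^ K + K ≤ x ^ (K + 1) := h1
      _ = Real.exp ((K + 1) * Real.log x) := h2
      _ < Real.exp (Real.log 2 * (c * Real.sqrt x)) := Real.exp_lt_exp.2 h4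
      _ = (2 : ℝ) ^ (c * Real.sqrt x) := h3.symm
  have := tendsto_natCast_atTop_atTop.eventually hreal
  filter_upwards [this] with n hn
  push_cast
  exact hn

/-- **No polynomial-size LP expresses the TSP**: for every exponent `K`, for all large `n`,
`TSP(n)` has no extended formulation with at most `n^K + K` inequalities.
[cite: FioriniEtAl2015, Thm. 12 (PDF p. 11) and §1 (PDF p. 3)] -/
theorem TSPExtensionComplexity.not_poly (h : TSPExtensionComplexity) (K : ℕ) :
    ∀ᶠ n : ℕ in atTop, ¬ HasEFOfSize (tspPolytope n) (n ^ K + K) := by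
  obtain ⟨c, hc, hev⟩ := h
  filter_upwards [hev, eventually_pow_add_lt_two_rpow_sqrt K hc] with n hn hgrow hEF
  exact absurd ((hn _ hEF).trans_lt hgrow) (lt_irrefl _)

/-- The `¬∃`-form of "it is impossible to prove `P = NP` by means of a polynomial-size LP that
expresses" the TSP: there is no polynomial bound `p(n) = n^K + K` such that `TSP(n)` has an
extended formulation of size `≤ p(n)` for infinitely many `n` (sizes are monotone,
`HasEFOfSize.of_le`). [cite: FioriniEtAl2015, §1 (PDF p. 3) and Thm. 12] -/
theorem TSPExtensionComplexity.no_polysize_ef (h : TSPExtensionComplexity) :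
    ¬ ∃ K : ℕ, ∃ᶠ n : ℕ in atTop, ∃ r : ℕ, r ≤ n ^ K + K ∧ HasEFOfSize (tspPolytope n) r := by
  rintro ⟨K, hfreq⟩
  refine ((h.not_poly K).and_frequently hfreq).exists.elim ?_
  rintro n ⟨hno, r, hr, hEF⟩
  exact hno (hEF.of_le hr)

end Literature.Barriers.PneNP

end
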